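import Literature.MathematicalPhysics.QuantumFieldTheory.Balaban1983to89.B8Thm2SetupTorusOfLettersPerB9
import Literature.MathematicalPhysics.QuantumFieldTheory.Balaban1983to89.T3SectALandauChart
import HarnessLib

/-!
# Route `UnitScaleTilt`, crux K1 child «MinimiserStabilityRegPr» (stmt-QuantumFields-19200) — **THE (T2) KNIT: the EX knit's [B8]-Theorem-2 binder
# `hThm2` ON THE T³ FAMILY, FROM THE v3 [4] LETTERS ALONE** (cell `ym-inputs`, seat `ym-inputs-p08`, input I-08 of `pub/ym-inputs/INPUT-LIST.md` v6)

The EX knit of record `Prop7StubEXOfChartPiecesTwL.stubEX_of_chartPiecesTwL` (p613913; same text in FILE B `…StubEXOfChartPiecesTw` :205 and every later knit) displays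
the binder

  `(hThm2 : ∀ (L : ℕ), 1 < L → ∃ B₁ c₁ : ℝ, 0 < B₁ ∧ 0 < c₁ ∧ ∀ (F : T3Family), F.L = L → ∀ (n K : ℕ), n < K → ∃ (β₀ B₂ : ℝ) (len : Site (F.P K).d → ℝ),`
  `   Thm2TorusAt (F.P K).L (K - n) (((F.P K).sitesPerDir 0 : ℕ) : ℤ) (eta F n K) β₀ B₁ B₂ c₁ len (specialUnitaryUnits (Fin 2)) (fun _ => True))`

— [Balaban1985RegularSpaces] Theorem 2 (p. 83) on `Ω_j = T_η` at every member `(F, n < K)` of the T³ family (level count `k = K − n`, period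
`P = 2·L^{m+K} ∈ Lᵏℤ`, spacing `η = L^{−(K−n)}`), ONE pair `(B₁, c₁)` per block size `L` (print p. 83: «absolute constants depending on d and L only»).
The Literature endpoint `B8Thm2TorusAtOfLettersPerB9.thm2TorusAt_specialUnitary_of_lettersPerB9` (lit-balaban t2s-1 g3, p616036; `G = SU(N)`, `N ≤ 25`,
`d, L ≥ 2`) supplies exactly this `Thm2TorusAt … (fun _ => True)` sentence, member-uniformly, MODULO the v3 [4] letters `LettersAllPer` + `LettersAllPerTau` and
nothing else.  THIS FILE specialises it to `N := 2`, `d := 3`, `L := F.L`, `k := K − n`, `P := (F.P K).sitesPerDir 0` (`B8Thm2SetupTorus.pow_dvd_period`),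
`η := eta F n K`, Hölder datum `β₀ := 0`, `B₁ := 5·3·L·B₀·(1 + 11·3²) + 1`:

* ★ `thm2TorusAt_T3_of_lettersPerB9` — the MEMBER-WISE form: per `L > 1` one pair `(B₁, c₁)`; then at every member the letters AT THAT MEMBER give
  `∃ β₀ B₂ len, Thm2TorusAt …`;
* ★★ `hThm2_of_lettersPer_T3` — the binder's text VERBATIM from the letters displayed at every member (the shape the knit assembler `exact`s).

DISPLAYED HYPOTHESES (all that is left of (T2)): per block size `L` the letters' constants `B₀ B₀' B₀'H B₂' B_G B_R B₀β c_{b9} β c_L : ℕ → ℝ` and length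
function `len : ℕ → Site 3 → ℝ` with the numerals `0 < B₀, B₀', B₀'H, c_{b9}, c_L`, `0 ≤ B₂', B_G, B_R`, `2 ≤ 15·L·B₀` (= `5dLB₀ ≥ 2`), `18·L²·B_G·(B_R + 2) ≤ B₀'`
(= the free-constant condition `3·(2dL²)·B_G·(B_R + 2) ≤ B₀'`), and PER MEMBER the v3 [4] letters `LettersAllPer (M₂ ℂ) (F.P K).L … (eta F n K) (K − n)
((F.P K).sitesPerDir 0) (specialUnitaryUnits (Fin 2))` with their `tr`-laws `LettersAllPerTau (trCLM (Fin 2))` — [Balaban1985BackgroundPropagators] Thms 3.1–3.3 on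
`T_η` (sub-row G-B9-LETTERS of cell `lit-balaban`; cited BY NAME, nothing restated here).  NO `SockB9P3` ∕ `SB9all` socket (resolved by G1–G3).

HONEST SCOPE.  A composition of landed engines (two `obtain`s and an index map); Theorem 2 is NOT re-proved here; the letters are NOT supplied here.
CONDITIONAL and COUNT-NEUTRAL: `stub_existenceMinimalOrbit` ∕ stmt-19200 ∕ stmt-20520 are NOT closed by this file (`--supports … --as helper`).  YM₃ on T³ is
ladder rung R3 (finite-torus SU(2), D-0061) — not T⁴, not infinite volume, not a mass gap, not the Clay problem; no summit or sub-problem statement is proved.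
THEOREMS ONLY (0 `def`, 0 `sorry`, 0 `instance`).

References: T. Bałaban, *Spaces of regular gauge field configurations on a lattice and gauge fixing conditions*, CMP **99** (1985) 75–102
[Balaban1985RegularSpaces] (Thm 2 p.83, (1.33)–(1.39) pp.82–83, p.77 «Ω_j = T_η», p.76 «G = SU(N)»); T. Bałaban, *Propagators for lattice gauge theories in a
background field*, CMP **99** (1985) 389–434 [Balaban1985BackgroundPropagators] (Thms 3.1–3.3 pp.397–399); T. Bałaban, CMP **102** (1985) 255–275 [Balaban1985UV3]
((1)–(3) p.256: the T³ family, `d = 3`, `2L^{m+K}` sites per direction).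
-/

set_option autoImplicit false

noncomputable section

open scoped BigOperators Matrix.Norms.L2Operator Matrix

namespace Summit.QuantumFields.YangMills.Theorems.Prop7Thm2OfLettersT3

open Literature.MathematicalPhysics.QuantumFieldTheory.Balaban1983to89
open Literature.MathematicalPhysics.QuantumFieldTheory.Balaban1983to89.T3ContinuumYM3Torus
open Literature.MathematicalPhysics.QuantumFieldTheory.Balaban1983to89.T3SectALandauChart (eta eta_pos)
open B8Thm2TorusAt (Thm2TorusAt)
open B7Prop2SpecialUnitary (specialUnitaryUnits)
open B8SpecialUnitaryTrace (trCLM)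
open B8Thm2TorusLettersPer (LettersAllPer LettersAllPerTau)
open B8Thm2SetupTorus (pow_dvd_period)
open B8Thm2TorusAtOfLettersPerB9 (thm2TorusAt_specialUnitary_of_lettersPerB9)

/-- ★ **[B8] THEOREM 2 ON `Ω_j = T_η` AT THE T³ MEMBERS, MEMBER-WISE, FROM THE v3 [4] LETTERS AT THAT MEMBER** — for every block size `L > 1`, given the letters'
constants at `L` with `0 < B₀, B₀', B₀'H, c_{b9}, c_L`, `0 ≤ B₂', B_G, B_R`, `2 ≤ 15·L·B₀`, `18·L²·B_G·(B_R + 2) ≤ B₀'`, there is ONE pair `B₁, c₁ > 0`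
(`B₁ = 1500·L·B₀ + 1`; `c₁` from `B8Thm2TorusAtOfLettersPerB9.thm2TorusAt_specialUnitary_of_lettersPerB9` at `N = 2`, `d = 3` — from `L` and the constants only)
such that at every member `(F, n < K)` with `F.L = L`, the v3 [4] letters `LettersAllPer (M₂ ℂ) (F.P K).L … (eta F n K) (K − n) ((F.P K).sitesPerDir 0) SU(2)` with
their `tr`-laws give `Thm2TorusAt (F.P K).L (K − n) ((F.P K).sitesPerDir 0) (eta F n K) 0 B₁ B₂ c₁ (len L) SU(2) (fun _ => True)` for some `B₂` (Hölder datum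
`β₀ = 0`): `k = K − n ≥ 1`, `η = L^{−(K−n)} > 0`, `Lᵏ ∣ 2·L^{m+K}` (`B8Thm2SetupTorus.pow_dvd_period`).  Conditional on the displayed letters; count-neutral.
[cite: Balaban1985RegularSpaces, Thm 2 p.83, p.83 («absolute constants depending on d and L only»), p.77 («Ω_j = T_η»), p.76 («G = SU(N)»); Balaban1985BackgroundPropagators, Thms 3.1–3.3 pp.397–399; Balaban1985UV3, (1)–(3) p.256] -/
theorem thm2TorusAt_T3_of_lettersPerB9
    (B₀ B₀' B₀'H B₂' BG BR B₀β cB9 β cL : ℕ → ℝ) (len : ℕ → B7Prop1Explicit.Site 3 → ℝ)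
    (hB₀ : ∀ L : ℕ, 1 < L → 0 < B₀ L) (hB₀' : ∀ L : ℕ, 1 < L → 0 < B₀' L) (hB : ∀ L : ℕ, 1 < L → 2 ≤ 15 * (L : ℝ) * B₀ L)
    (hB₀'H : ∀ L : ℕ, 1 < L → 0 < B₀'H L) (hB₂' : ∀ L : ℕ, 1 < L → 0 ≤ B₂' L) (hBG : ∀ L : ℕ, 1 < L → 0 ≤ BG L) (hBR : ∀ L : ℕ, 1 < L → 0 ≤ BR L)
    (hcB9 : ∀ L : ℕ, 1 < L → 0 < cB9 L) (hcL : ∀ L : ℕ, 1 < L → 0 < cL L)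
    (hfree : ∀ L : ℕ, 1 < L → 18 * (L : ℝ) ^ 2 * BG L * (BR L + 2) ≤ B₀' L) :
    letI : CStarAlgebra (Matrix (Fin 2) (Fin 2) ℂ) := {}
    ∀ (L : ℕ), 1 < L → ∃ B₁ c₁ : ℝ, 0 < B₁ ∧ 0 < c₁ ∧ ∀ (F : T3Family), F.L = L → ∀ (n K : ℕ), n < K →
      ∀ ℓP : LettersAllPer (𝔸 := Matrix (Fin 2) (Fin 2) ℂ) (F.P K).L (BG F.L) (BR F.L) (B₀'H F.L) (B₂' F.L) (B₀ F.L) (B₀β F.L) (cB9 F.L) (β F.L)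
          (len F.L) (cL F.L) (eta F n K) (K - n) ((((F.P K).sitesPerDir 0 : ℕ) : ℤ)) (specialUnitaryUnits (Fin 2)),
        LettersAllPerTau (𝔸 := Matrix (Fin 2) (Fin 2) ℂ) (trCLM (Fin 2)) ℓP →
      ∃ (β₀ B₂ : ℝ) (len : B7Prop1Explicit.Site (F.P K).d → ℝ),
        Thm2TorusAt (F.P K).L (K - n) ((((F.P K).sitesPerDir 0 : ℕ) : ℤ)) (eta F n K) β₀ B₁ B₂ c₁ len (specialUnitaryUnits (Fin 2)) (fun _ => True) := by
  letI : CStarAlgebra (Matrix (Fin 2) (Fin 2) ℂ) := {}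
  intro L hL
  have hL2 : 2 ≤ L := hL
  -- the numerals at `d = 3`
  have hB3 : 2 ≤ 5 * ((3 : ℕ) : ℝ) * L * B₀ L := by have := hB L hL; push_cast; linarith
  have hfree3 : 3 * (2 * ((3 : ℕ) : ℝ) * (L : ℝ) ^ 2) * BG L * (BR L + 2) ≤ B₀' L := by have := hfree L hL; push_cast; linarith
  have hB₁ : 5 * ((3 : ℕ) : ℝ) * L * B₀ L * (1 + 11 * ((3 : ℕ) : ℝ) ^ 2) < 5 * (3 : ℝ) * L * B₀ L * (1 + 11 * (3 : ℝ) ^ 2) + 1 := by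
    push_cast; linarith
  -- Theorem 2 on `T_η` for `SU(2)`, `d = 3`, block size `L`, modulo the letters: ONE `(B₂, c₁)` for all `k, P, η`
  obtain ⟨B₂, c₁, hB₂, hc₁, H⟩ := thm2TorusAt_specialUnitary_of_lettersPerB9 (N := 2) (d := 3) (L := L)
    (B₀β := B₀β L) (β := β L) (len := len L) (by norm_num) (by norm_num) hL2
    (hB₀ L hL) (hB₀' L hL) hB3 (hB₀'H L hL) (hB₂' L hL) (hBG L hL) (hBR L hL) (hcB9 L hL) (hcL L hL) hfree3 hB₁
  refine ⟨5 * (3 : ℝ) * L * B₀ L * (1 + 11 * (3 : ℝ) ^ 2) + 1, c₁, ?_, hc₁, ?_⟩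
  · have := hB₀ L hL; positivity
  intro F hF n K hnK ℓP ℓPτ
  subst hF
  -- the member's index map: `k = K − n ≥ 1`, `η = L^{−(K−n)} > 0`, `P = 2·L^{m+K} ∈ L^{K−n}ℤ`
  have hk : 1 ≤ K - n := by omega
  have hP : ∃ M : ℤ, ((((F.P K).sitesPerDir 0 : ℕ) : ℤ)) = ((F.P K).L : ℤ) ^ (K - n) * M :=
    pow_dvd_period (F.P K) (j := 0) (k := K - n) (by show K - n ≤ F.m + K - 0; omega)
  exact ⟨0, B₂, len F.L, H (K - n) _ (eta F n K) hk (eta_pos F n K) hP ℓP ℓPτ⟩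

/-- ★★ **THE (T2) BINDER `hThm2` OF THE EX KNIT, VERBATIM, FROM THE v3 [4] LETTERS DISPLAYED AT EVERY T³ MEMBER** — given, per block size `L`, the letters'
constants and length function with the numerals of `thm2TorusAt_T3_of_lettersPerB9`, and AT EVERY member `(F, n < K)` the v3 [4] letters
`LettersAllPer (M₂ ℂ) (F.P K).L (B_G F.L) … (len F.L) (c_L F.L) (eta F n K) (K − n) ((F.P K).sitesPerDir 0) (specialUnitaryUnits (Fin 2))` with their `tr`-laws
([Balaban1985BackgroundPropagators] Thms 3.1–3.3 on `T_η`; sub-row G-B9-LETTERS), the text of `Prop7StubEXOfChartPiecesTwL.stubEX_of_chartPiecesTwL`'s binder `hThm2`: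
`∀ L > 1, ∃ B₁ c₁ > 0, ∀ F, F.L = L → ∀ n K, n < K → ∃ β₀ B₂ len, Thm2TorusAt (F.P K).L (K − n) ((F.P K).sitesPerDir 0) (eta F n K) β₀ B₁ B₂ c₁ len SU(2) (fun _ => True)`.
Conditional on the displayed letters; count-neutral (the EX stub is not closed).
[cite: Balaban1985RegularSpaces, Thm 2 p.83, (1.33)–(1.39) pp.82–83, p.77 («Ω_j = T_η»), p.76 («G = SU(N)»); Balaban1985BackgroundPropagators, Thms 3.1–3.3 pp.397–399; Balaban1985UV3, (1)–(3) p.256] -/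
theorem hThm2_of_lettersPer_T3
    (B₀ B₀' B₀'H B₂' BG BR B₀β cB9 β cL : ℕ → ℝ) (len : ℕ → B7Prop1Explicit.Site 3 → ℝ)
    (hB₀ : ∀ L : ℕ, 1 < L → 0 < B₀ L) (hB₀' : ∀ L : ℕ, 1 < L → 0 < B₀' L) (hB : ∀ L : ℕ, 1 < L → 2 ≤ 15 * (L : ℝ) * B₀ L)
    (hB₀'H : ∀ L : ℕ, 1 < L → 0 < B₀'H L) (hB₂' : ∀ L : ℕ, 1 < L → 0 ≤ B₂' L) (hBG : ∀ L : ℕ, 1 < L → 0 ≤ BG L) (hBR : ∀ L : ℕ, 1 < L → 0 ≤ BR L)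
    (hcB9 : ∀ L : ℕ, 1 < L → 0 < cB9 L) (hcL : ∀ L : ℕ, 1 < L → 0 < cL L)
    (hfree : ∀ L : ℕ, 1 < L → 18 * (L : ℝ) ^ 2 * BG L * (BR L + 2) ≤ B₀' L) :
    letI : CStarAlgebra (Matrix (Fin 2) (Fin 2) ℂ) := {}
    ∀ (ℓP : ∀ (F : T3Family) (n K : ℕ), n < K →
        LettersAllPer (𝔸 := Matrix (Fin 2) (Fin 2) ℂ) (F.P K).L (BG F.L) (BR F.L) (B₀'H F.L) (B₂' F.L) (B₀ F.L) (B₀β F.L) (cB9 F.L) (β F.L)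
          (len F.L) (cL F.L) (eta F n K) (K - n) ((((F.P K).sitesPerDir 0 : ℕ) : ℤ)) (specialUnitaryUnits (Fin 2))),
      (∀ (F : T3Family) (n K : ℕ) (hnK : n < K), LettersAllPerTau (𝔸 := Matrix (Fin 2) (Fin 2) ℂ) (trCLM (Fin 2)) (ℓP F n K hnK)) →
      ∀ (L : ℕ), 1 < L → ∃ B₁ c₁ : ℝ, 0 < B₁ ∧ 0 < c₁ ∧ ∀ (F : T3Family), F.L = L → ∀ (n K : ℕ), n < K →
        ∃ (β₀ B₂ : ℝ) (len : B7Prop1Explicit.Site (F.P K).d → ℝ),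
          Thm2TorusAt (F.P K).L (K - n) ((((F.P K).sitesPerDir 0 : ℕ) : ℤ)) (eta F n K) β₀ B₁ B₂ c₁ len (specialUnitaryUnits (Fin 2)) (fun _ => True) := by
  intro ℓP ℓPτ L hL
  obtain ⟨B₁, c₁, hB₁, hc₁, H⟩ := thm2TorusAt_T3_of_lettersPerB9 B₀ B₀' B₀'H B₂' BG BR B₀β cB9 β cL len hB₀ hB₀' hB hB₀'H hB₂' hBG hBR hcB9 hcL hfree L hL
  exact ⟨B₁, c₁, hB₁, hc₁, fun F hF n K hnK => H F hF n K hnK (ℓP F n K hnK) (ℓPτ F n K hnK)⟩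

end Summit.QuantumFields.YangMills.Theorems.Prop7Thm2OfLettersT3

end
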